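import Literature.Barriers.Parity.SiegelZeroDichotomyPairHLSieveEuler
import Literature.Barriers.Parity.SiegelZeroDichotomyChowlaStep3Mertens
import Literature.NumberTheory.Sieve.PolynomialCongruencesRoughAP
import HarnessLib

/-!
# Tao–Teräväinen 2022, Lemma 3.4 at `k = 2`: the local factors `E_p` and the pointwise bound

Topic `Literature/Barriers/Parity`, sub-namespace `TaoTeravainen`; fourth file of the proof of
Tao–Teräväinen's Lemma 3.4 (arXiv:2109.06291, §3.2) at `k = 2`, after `…SieveExpansion.lean`,
`…SieveFourier.lean`, `…SieveEuler.lean` (where `K_Y(τ) = outsideFactor · ∏_{p<R} E_p`).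
Everything here is PROVED.

The source estimates the local factors as follows: for `p ≤ R` with `d'_(p) = 1`,
"`F_p(0,…,0) = β_p(1-1/p)^k`" and "From the Cauchy integral formula … `E_p = β_p(1-1/p)^k +
O(min(σ log_R p, 1)/p)`"; for `p ≤ R` with `d'_(p) > 1`, "`F_p ≪ 1/d'_(p)` … while from the
cancellation in the Möbius coefficients … `F_p(0,…,0) = 0` … `E_p d'_(p) ≪ min(σ log_R p, 1)`";
then "From Mertens' theorem (3.4) … `∏_{p ≤ R}(1 + O(min(σ log_R p,1)/p) + O(1/p²)) ≪ σ^{O(1)}`"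
and "by Mertens' theorem (3.5) `∏_p E_p d'_(p) ≪ σ^{O(1)} τ(d'')^{O(1)}/log^k R ∏_{p≤R: p∣d} min(σ log_R p, 1)`".
[cite: TaoTeravainen2021, §3.2 (proof of Lemma 3.4, the estimates for `E_p`)]

Here, at `k = 2` and with explicit constants (the Cauchy integral formula is replaced by the
explicit multilinear form of `E_p` in the four slot powers `u_k = p^{w_k}`):

* `crtCoeff`, `sum_finset_fin_four`, `localFactor_eq` — `E_p = c(0,0) + c(1,0)S₀ + c(0,1)S₁ + c(1,1)S₀S₁`,
  `S₀ = (1-u₀)(1-u₁) - 1`, `S₁ = (1-u₂)(1-u₃) - 1`;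
* `norm_localFactor_generic_le` (`p ∤ d₀d₁(h₁-h₂)`: `‖E_p‖ ≤ (1-1/p)²(1 + 8m²/p)` if `‖1-u_k‖ ≤ m`),
  `norm_localFactor_dvd_shift_le` (`p ∣ h₁-h₂`, `p ∤ d₀d₁`: `‖E_p‖ ≤ 163`),
  `norm_localFactor_dvd_le` (`p ∣ d₀d₁`: `‖E_p‖ ≤ 18 m² c(0,0)`, the Möbius cancellation), and
  `crtCoeff_zero_zero_le` (`c(0,0) ≤ p^{v_p(h₁-h₂)}/p^{v_p d₀ + v_p d₁}`, i.e. "`d ≍ d₁⋯d_{k'}`");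
* `tauSize τ = σ_τ = 1 + ∑|τ_k|`, `gainMin R σ p = min(σ log_R p, 1)`,
  `norm_one_sub_cpow_slotExp_le` (`‖1 - p^{s_{τ_k}}‖ ≤ min(2πσ log_R p, 4)`, from the tree's
  `norm_cpow_sub_one_le`), `min_sq_le_gainMin` (`m² ≤ 27 min(σ log_R p,1)`);
* `gainWeight R d σ = 1944^{ω(d₀d₁)}/(d₀d₁) ∏_{p∣d₀d₁, p<R} min(σ log_R p, 1)`, `kernelConst`,
  `sum_gainMin_div_le` ((3.3) at `z = R`, the tree's `sum_min_div_prime_le`), Mertens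
  (`prod_primesBelow_one_sub_inv_le`), and **`norm_sieveKernel_le`** —
  `‖K_Y(τ)‖ ≤ C_K σ_τ^{216}/log² R · gainWeight R d σ_τ` for `R ≥ 3`, `h₁ ≠ h₂`, `d₀,d₁ ≥ 1`.
-/

noncomputable section

open Finset
open scoped ArithmeticFunction.Moebius

namespace Literature.Barriers.Parity

namespace TaoTeravainen

/-! ### The local factor as an explicit polynomial in the four slot powers -/

/-- The density coefficient as a function of the two side indicators `ε₀, ε₁ ∈ {0,1}`:
`c(ε₀,ε₁) = 1_{min(max(a₀,ε₀), max(a₁,ε₁)) ≤ v_p H} p^{-max(max(a₀,ε₀), max(a₁,ε₁))}`.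
[cite: TaoTeravainen2021, §3.2 (proof of Lemma 3.4, `F_p`)] -/
def crtCoeff (p vH : ℕ) (a : Fin 2 → ℕ) (e₀ e₁ : ℕ) : ℝ :=
  if min (max (a 0) e₀) (max (a 1) e₁) ≤ vH then
    ((p : ℝ) ^ max (max (a 0) e₀) (max (a 1) e₁))⁻¹ else 0

/-- `c ≥ 0`. [folklore] -/
theorem crtCoeff_nonneg (p vH : ℕ) (a : Fin 2 → ℕ) (e₀ e₁ : ℕ) : 0 ≤ crtCoeff p vH a e₀ e₁ := by
  unfold crtCoeff
  split_ifs <;> positivity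

/-- `localCrt(X) = c(sideHit X 0, sideHit X 1)`. [folklore] -/
theorem localCrt_eq_crtCoeff (p vH : ℕ) (a : Fin 2 → ℕ) (X : Finset (Fin 4)) :
    localCrt p vH a X = crtCoeff p vH a (sideHit X 0) (sideHit X 1) := rfl

/-- The sum over the sixteen subsets of the four slots, written out. [folklore] -/
theorem sum_finset_fin_four {M : Type*} [AddCommMonoid M] (F : Finset (Fin 4) → M) :
    ∑ X : Finset (Fin 4), F X =
      F ∅ + F {3} + (F {2} + F {2, 3}) + (F {1} + F {1, 3} + (F {1, 2} + F {1, 2, 3})) +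
        (F {0} + F {0, 3} + (F {0, 2} + F {0, 2, 3}) +
          (F {0, 1} + F {0, 1, 3} + (F {0, 1, 2} + F {0, 1, 2, 3}))) := by
  have huniv : (Finset.univ : Finset (Finset (Fin 4))) =
      Finset.powerset (insert (0 : Fin 4) (insert 1 (insert 2 ({3} : Finset (Fin 4))))) := by
    rw [← Finset.powerset_univ]
    congr 1
  have h3 : ({3} : Finset (Fin 4)) = insert 3 ∅ := rfl
  rw [huniv, Finset.sum_powerset_insert (by decide), Finset.sum_powerset_insert (by decide),
    Finset.sum_powerset_insert (by decide), Finset.sum_powerset_insert (by decide),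
    Finset.sum_powerset_insert (by decide), Finset.sum_powerset_insert (by decide),
    Finset.sum_powerset_insert (by decide), h3,
    Finset.sum_powerset_insert (by decide), Finset.sum_powerset_insert (by decide),
    Finset.sum_powerset_insert (by decide), Finset.sum_powerset_insert (by decide),
    Finset.sum_powerset_insert (by decide), Finset.sum_powerset_insert (by decide),
    Finset.sum_powerset_insert (by decide), Finset.sum_powerset_insert (by decide),
    Finset.powerset_empty]
  simp only [Finset.sum_singleton]
  rfl

/-- **`E_p` as a polynomial**: with `u_k = p^{w_k}`, `S₀ = (1-u₀)(1-u₁) - 1`, `S₁ = (1-u₂)(1-u₃) - 1`,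
`E_p = c(0,0) + c(1,0) S₀ + c(0,1) S₁ + c(1,1) S₀ S₁` (group the sixteen patterns `X` by the sides
they meet). [cite: TaoTeravainen2021, §3.2 (proof of Lemma 3.4, `F_p`)] -/
theorem localFactor_eq (p vH : ℕ) (a : Fin 2 → ℕ) (w : Fin 4 → ℂ) :
    localFactor p vH a w =
      ((crtCoeff p vH a 0 0 : ℝ) : ℂ) +
        ((crtCoeff p vH a 1 0 : ℝ) : ℂ) *
          ((1 - (p : ℂ) ^ w 0) * (1 - (p : ℂ) ^ w 1) - 1) +
        ((crtCoeff p vH a 0 1 : ℝ) : ℂ) *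
          ((1 - (p : ℂ) ^ w 2) * (1 - (p : ℂ) ^ w 3) - 1) +
        ((crtCoeff p vH a 1 1 : ℝ) : ℂ) *
          (((1 - (p : ℂ) ^ w 0) * (1 - (p : ℂ) ^ w 1) - 1) *
            ((1 - (p : ℂ) ^ w 2) * (1 - (p : ℂ) ^ w 3) - 1)) := by
  unfold localFactor
  rw [sum_finset_fin_four]
  simp only [localCrt_eq_crtCoeff, sideHit, slotSide, Finset.prod_empty, Finset.prod_singleton]
  simp [Finset.prod_insert]
  ring


/-! ### Bounds for the local factors -/

section LocalBounds

variable {p vH : ℕ} {a : Fin 2 → ℕ} {w : Fin 4 → ℂ} {m : ℝ}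

/-- `‖(1-u)(1-u')‖ ≤ m²` and `‖(1-u)(1-u') - 1‖ ≤ m² + 1` when `‖1 - u‖, ‖1 - u'‖ ≤ m`. [folklore] -/
theorem norm_sideSum_le {u u' : ℂ} (hm : 0 ≤ m) (hu : ‖1 - u‖ ≤ m) (hu' : ‖1 - u'‖ ≤ m) :
    ‖(1 - u) * (1 - u')‖ ≤ m ^ 2 ∧ ‖(1 - u) * (1 - u') - 1‖ ≤ m ^ 2 + 1 := by
  have h1 : ‖(1 - u) * (1 - u')‖ ≤ m ^ 2 := by
    rw [norm_mul, sq]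
    exact mul_le_mul hu hu' (norm_nonneg _) hm
  refine ⟨h1, ?_⟩
  calc ‖(1 - u) * (1 - u') - 1‖ ≤ ‖(1 - u) * (1 - u')‖ + ‖(1 : ℂ)‖ := norm_sub_le _ _
    _ ≤ m ^ 2 + 1 := by rw [norm_one]; linarith

/-- **The generic prime** (`p ∤ d₀ d₁ (h₁ - h₂)`): `E_p = 1 - 2/p + ((1-u₀)(1-u₁) + (1-u₂)(1-u₃))/p`,
so `‖E_p‖ ≤ (1 - 1/p)² (1 + 8m²/p)` when `‖1 - u_k‖ ≤ m` ("`F_p(0,…,0) = β_p(1-1/p)^k`" and the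
Cauchy estimate `E_p = β_p(1-1/p)^k + O(min(σ log_R p,1)/p)`; here `β_p (1-1/p)² = 1 - 2/p`).
[cite: TaoTeravainen2021, §3.2 (proof of Lemma 3.4, the case `p ≤ R`, `d'_(p) = 1`)] -/
theorem norm_localFactor_generic_le (hp : 2 ≤ p) (ha0 : a 0 = 0) (ha1 : a 1 = 0) (hm : 0 ≤ m)
    (hu : ∀ k, ‖1 - (p : ℂ) ^ w k‖ ≤ m) :
    ‖localFactor p 0 a w‖ ≤ (1 - (p : ℝ)⁻¹) ^ 2 * (1 + 8 * m ^ 2 / p) := by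
  have hp0 : (0 : ℝ) < p := by exact_mod_cast (show 0 < p by omega)
  have hp2 : (2 : ℝ) ≤ p := by exact_mod_cast hp
  have hc00 : crtCoeff p 0 a 0 0 = 1 := by simp [crtCoeff, ha0, ha1]
  have hc10 : crtCoeff p 0 a 1 0 = (p : ℝ)⁻¹ := by simp [crtCoeff, ha0, ha1]
  have hc01 : crtCoeff p 0 a 0 1 = (p : ℝ)⁻¹ := by simp [crtCoeff, ha0, ha1]
  have hc11 : crtCoeff p 0 a 1 1 = 0 := by simp [crtCoeff, ha0, ha1]
  rw [localFactor_eq, hc00, hc10, hc01, hc11]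
  set P₀ := (1 - (p : ℂ) ^ w 0) * (1 - (p : ℂ) ^ w 1) with hP₀
  set P₁ := (1 - (p : ℂ) ^ w 2) * (1 - (p : ℂ) ^ w 3) with hP₁
  have hP₀n : ‖P₀‖ ≤ m ^ 2 := (norm_sideSum_le hm (hu 0) (hu 1)).1
  have hP₁n : ‖P₁‖ ≤ m ^ 2 := (norm_sideSum_le hm (hu 2) (hu 3)).1
  have hrw : (((1 : ℝ) : ℝ) : ℂ) + (((p : ℝ)⁻¹ : ℝ) : ℂ) * (P₀ - 1) + (((p : ℝ)⁻¹ : ℝ) : ℂ) * (P₁ - 1) +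
      (((0 : ℝ) : ℝ) : ℂ) * ((P₀ - 1) * (P₁ - 1)) =
      (((1 - 2 * (p : ℝ)⁻¹ : ℝ)) : ℂ) + (((p : ℝ)⁻¹ : ℝ) : ℂ) * (P₀ + P₁) := by
    push_cast
    ring
  rw [hrw]
  have hmain : 0 ≤ 1 - 2 * (p : ℝ)⁻¹ := by
    rw [sub_nonneg, inv_eq_one_div]
    have : 2 * (1 / (p : ℝ)) = 2 / p := by ring
    rw [this, div_le_one hp0]
    exact hp2
  calc ‖(((1 - 2 * (p : ℝ)⁻¹ : ℝ)) : ℂ) + (((p : ℝ)⁻¹ : ℝ) : ℂ) * (P₀ + P₁)‖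
      ≤ ‖(((1 - 2 * (p : ℝ)⁻¹ : ℝ)) : ℂ)‖ + ‖(((p : ℝ)⁻¹ : ℝ) : ℂ) * (P₀ + P₁)‖ := norm_add_le _ _
    _ ≤ (1 - 2 * (p : ℝ)⁻¹) + (p : ℝ)⁻¹ * (m ^ 2 + m ^ 2) := by
        gcongr
        · rw [Complex.norm_real, Real.norm_eq_abs, abs_of_nonneg hmain]
        · rw [norm_mul, Complex.norm_real, Real.norm_eq_abs, abs_of_nonneg (by positivity)]
          exact mul_le_mul_of_nonneg_left ((norm_add_le _ _).trans (add_le_add hP₀n hP₁n))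
            (by positivity)
    _ ≤ (1 - (p : ℝ)⁻¹) ^ 2 * (1 + 8 * m ^ 2 / p) := by
        -- `1 - 2/p ≤ (1-1/p)²` and `(1-1/p)² ≥ 1/4`
        have hq : (1 : ℝ) / 4 ≤ (1 - (p : ℝ)⁻¹) ^ 2 := by
          have : (1 : ℝ) / 2 ≤ 1 - (p : ℝ)⁻¹ := by
            rw [inv_eq_one_div]
            have : (1 : ℝ) / p ≤ 1 / 2 := one_div_le_one_div_of_le two_pos hp2
            linarith
          nlinarith
        have hsq : 1 - 2 * (p : ℝ)⁻¹ ≤ (1 - (p : ℝ)⁻¹) ^ 2 := by nlinarith [sq_nonneg ((p : ℝ)⁻¹)]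
        have hm2 : 0 ≤ 8 * m ^ 2 / p := by positivity
        have : (p : ℝ)⁻¹ * (m ^ 2 + m ^ 2) = 2 * (m ^ 2 / p) := by
          rw [div_eq_mul_inv]; ring
        rw [this]
        have h3 : 2 * (m ^ 2 / p) ≤ (1 - (p : ℝ)⁻¹) ^ 2 * (8 * m ^ 2 / p) := by
          have := mul_le_mul_of_nonneg_right hq hm2
          have h4 : (1 : ℝ) / 4 * (8 * m ^ 2 / p) = 2 * (m ^ 2 / p) := by ring
          linarith
        have h5 : (1 - (p : ℝ)⁻¹) ^ 2 * (1 + 8 * m ^ 2 / p) =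
            (1 - (p : ℝ)⁻¹) ^ 2 + (1 - (p : ℝ)⁻¹) ^ 2 * (8 * m ^ 2 / p) := by ring
        linarith

/-- **A prime dividing `h₁ - h₂` but not `d₀ d₁`**: `‖E_p‖ ≤ 163` when `‖1 - u_k‖ ≤ m ≤ 4`.
[cite: TaoTeravainen2021, §3.2 (proof of Lemma 3.4)] -/
theorem norm_localFactor_dvd_shift_le (hp : 2 ≤ p) (hvH : 1 ≤ vH) (ha0 : a 0 = 0) (ha1 : a 1 = 0)
    (hm : 0 ≤ m) (hm4 : m ≤ 4) (hu : ∀ k, ‖1 - (p : ℂ) ^ w k‖ ≤ m) :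
    ‖localFactor p vH a w‖ ≤ 163 := by
  have hp0 : (0 : ℝ) < p := by exact_mod_cast (show 0 < p by omega)
  have hp2 : (2 : ℝ) ≤ p := by exact_mod_cast hp
  have hvH0 : ¬ vH = 0 := by omega
  have hc00 : crtCoeff p vH a 0 0 = 1 := by simp [crtCoeff, ha0, ha1]
  have hc10 : crtCoeff p vH a 1 0 = (p : ℝ)⁻¹ := by simp [crtCoeff, ha0, ha1]
  have hc01 : crtCoeff p vH a 0 1 = (p : ℝ)⁻¹ := by simp [crtCoeff, ha0, ha1]
  have hc11 : crtCoeff p vH a 1 1 = (p : ℝ)⁻¹ := by simp [crtCoeff, ha0, ha1, hvH]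
  rw [localFactor_eq, hc00, hc10, hc01, hc11]
  set S₀ := (1 - (p : ℂ) ^ w 0) * (1 - (p : ℂ) ^ w 1) - 1 with hS₀
  set S₁ := (1 - (p : ℂ) ^ w 2) * (1 - (p : ℂ) ^ w 3) - 1 with hS₁
  have hS₀n : ‖S₀‖ ≤ 17 := by
    have := (norm_sideSum_le hm (hu 0) (hu 1)).2
    nlinarith
  have hS₁n : ‖S₁‖ ≤ 17 := by
    have := (norm_sideSum_le hm (hu 2) (hu 3)).2
    nlinarith
  have hpinv : ‖(((p : ℝ)⁻¹ : ℝ) : ℂ)‖ ≤ 1 / 2 := by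
    rw [Complex.norm_real, Real.norm_eq_abs, abs_of_nonneg (by positivity), inv_eq_one_div]
    exact one_div_le_one_div_of_le two_pos hp2
  have hpinv0 : 0 ≤ ‖(((p : ℝ)⁻¹ : ℝ) : ℂ)‖ := norm_nonneg _
  calc ‖(((1 : ℝ) : ℝ) : ℂ) + (((p : ℝ)⁻¹ : ℝ) : ℂ) * S₀ + (((p : ℝ)⁻¹ : ℝ) : ℂ) * S₁ +
        (((p : ℝ)⁻¹ : ℝ) : ℂ) * (S₀ * S₁)‖
      ≤ ‖(((1 : ℝ) : ℝ) : ℂ)‖ + ‖(((p : ℝ)⁻¹ : ℝ) : ℂ) * S₀‖ + ‖(((p : ℝ)⁻¹ : ℝ) : ℂ) * S₁‖ +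
        ‖(((p : ℝ)⁻¹ : ℝ) : ℂ) * (S₀ * S₁)‖ := by
          refine (norm_add_le _ _).trans (add_le_add ((norm_add_le _ _).trans
            (add_le_add (norm_add_le _ _) le_rfl)) le_rfl)
    _ ≤ 1 + (1 / 2) * 17 + (1 / 2) * 17 + (1 / 2) * (17 * 17) := by
          rw [norm_mul, norm_mul, norm_mul, norm_mul]
          gcongr
          · simp
    _ ≤ 163 := by norm_num

/-- Monotonicity of the density coefficient: `c(ε₀,ε₁) ≤ c(0,0) = 1_{min(a₀,a₁) ≤ v_pH} p^{-max(a₀,a₁)}`.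
[folklore] -/
theorem crtCoeff_le_zero_zero (hp : 1 ≤ p) (e₀ e₁ : ℕ) :
    crtCoeff p vH a e₀ e₁ ≤ crtCoeff p vH a 0 0 := by
  have hp1 : (1 : ℝ) ≤ p := by exact_mod_cast hp
  have hp0 : (0 : ℝ) < p := by linarith
  unfold crtCoeff
  rw [Nat.max_zero, Nat.max_zero]
  by_cases h : min (max (a 0) e₀) (max (a 1) e₁) ≤ vH
  · rw [if_pos h, if_pos ((min_le_min (le_max_left _ _) (le_max_left _ _)).trans h)]
    rw [inv_eq_one_div, inv_eq_one_div]
    refine one_div_le_one_div_of_le (by positivity) ?_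
    exact pow_le_pow_right₀ hp1 (max_le_max (le_max_left _ _) (le_max_left _ _))
  · rw [if_neg h]
    split_ifs <;> positivity

/-- `c(0,0)` explicitly. [folklore] -/
theorem crtCoeff_zero_zero (p vH : ℕ) (a : Fin 2 → ℕ) :
    crtCoeff p vH a 0 0 =
      if min (a 0) (a 1) ≤ vH then ((p : ℝ) ^ max (a 0) (a 1))⁻¹ else 0 := by
  simp [crtCoeff]

/-- **A prime dividing `d₀ d₁`** ("from the cancellation in the Möbius coefficients … `F_p(0,…,0) = 0`
… `E_p d'_(p) ≪ min(σ log_R p, 1)`"): if `a₀ ≥ 1` or `a₁ ≥ 1` then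
`‖E_p‖ ≤ 18 m² c(0,0)` when `‖1 - u_k‖ ≤ m ≤ 4` (for `a₀ ≥ 1` the side-`0` patterns contribute the
factor `(1-u₀)(1-u₁)` exactly). [cite: TaoTeravainen2021, §3.2 (proof of Lemma 3.4, the case `d'_(p) > 1`)] -/
theorem norm_localFactor_dvd_le (hp : 1 ≤ p) (ha : a 0 ≠ 0 ∨ a 1 ≠ 0) (hm : 0 ≤ m) (hm4 : m ≤ 4)
    (hu : ∀ k, ‖1 - (p : ℂ) ^ w k‖ ≤ m) :
    ‖localFactor p vH a w‖ ≤ 18 * m ^ 2 * crtCoeff p vH a 0 0 := by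
  have hc0 : 0 ≤ crtCoeff p vH a 0 0 := crtCoeff_nonneg _ _ _ _ _
  rw [localFactor_eq]
  set P₀ := (1 - (p : ℂ) ^ w 0) * (1 - (p : ℂ) ^ w 1) with hP₀
  set P₁ := (1 - (p : ℂ) ^ w 2) * (1 - (p : ℂ) ^ w 3) with hP₁
  have hP₀n : ‖P₀‖ ≤ m ^ 2 := (norm_sideSum_le hm (hu 0) (hu 1)).1
  have hP₁n : ‖P₁‖ ≤ m ^ 2 := (norm_sideSum_le hm (hu 2) (hu 3)).1
  have hS₀n : ‖P₀ - 1‖ ≤ 17 := by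
    have := (norm_sideSum_le hm (hu 0) (hu 1)).2
    nlinarith
  have hS₁n : ‖P₁ - 1‖ ≤ 17 := by
    have := (norm_sideSum_le hm (hu 2) (hu 3)).2
    nlinarith
  -- a generic estimate for `(Q)(c + c' S)` with `‖Q‖ ≤ m²`, `‖S‖ ≤ 17`, `0 ≤ c' ≤ c`
  have key : ∀ (Q S : ℂ) (c c' : ℝ), ‖Q‖ ≤ m ^ 2 → ‖S‖ ≤ 17 → 0 ≤ c' → c' ≤ c →
      ‖Q * ((((c : ℝ)) : ℂ) + (((c' : ℝ)) : ℂ) * S)‖ ≤ 18 * m ^ 2 * c := by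
    intro Q S c c' hQ hS hc' hcc'
    have hc : 0 ≤ c := hc'.trans hcc'
    rw [norm_mul]
    have h2 : ‖((c : ℝ) : ℂ) + ((c' : ℝ) : ℂ) * S‖ ≤ c + c' * 17 := by
      calc ‖((c : ℝ) : ℂ) + ((c' : ℝ) : ℂ) * S‖ ≤ ‖((c : ℝ) : ℂ)‖ + ‖((c' : ℝ) : ℂ) * S‖ :=
            norm_add_le _ _
        _ ≤ c + c' * 17 := by
            rw [norm_mul, Complex.norm_real, Complex.norm_real, Real.norm_eq_abs,
              Real.norm_eq_abs, abs_of_nonneg hc, abs_of_nonneg hc']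
            gcongr
    calc ‖Q‖ * ‖((c : ℝ) : ℂ) + ((c' : ℝ) : ℂ) * S‖ ≤ m ^ 2 * (c + c' * 17) :=
          mul_le_mul hQ h2 (norm_nonneg _) (by positivity)
      _ ≤ m ^ 2 * (c + c * 17) := by gcongr
      _ = 18 * m ^ 2 * c := by ring
  rcases ha with ha0 | ha1
  · -- `a₀ ≥ 1`: `c(1,0) = c(0,0)`, `c(1,1) = c(0,1)`
    have h10 : crtCoeff p vH a 1 0 = crtCoeff p vH a 0 0 := by
      unfold crtCoeff
      rw [max_eq_left (Nat.one_le_iff_ne_zero.mpr ha0)]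
      simp only [Nat.max_zero]
    have h11 : crtCoeff p vH a 1 1 = crtCoeff p vH a 0 1 := by
      unfold crtCoeff
      rw [max_eq_left (Nat.one_le_iff_ne_zero.mpr ha0)]
      simp only [Nat.max_zero]
    rw [h10, h11]
    have hfac : ((crtCoeff p vH a 0 0 : ℝ) : ℂ) + ((crtCoeff p vH a 0 0 : ℝ) : ℂ) * (P₀ - 1) +
        ((crtCoeff p vH a 0 1 : ℝ) : ℂ) * (P₁ - 1) +
        ((crtCoeff p vH a 0 1 : ℝ) : ℂ) * ((P₀ - 1) * (P₁ - 1)) =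
        P₀ * (((crtCoeff p vH a 0 0 : ℝ) : ℂ) + ((crtCoeff p vH a 0 1 : ℝ) : ℂ) * (P₁ - 1)) := by
      ring
    rw [hfac]
    exact key P₀ (P₁ - 1) _ _ hP₀n hS₁n (crtCoeff_nonneg _ _ _ _ _)
      (crtCoeff_le_zero_zero hp 0 1)
  · -- `a₁ ≥ 1`: `c(0,1) = c(0,0)`, `c(1,1) = c(1,0)`
    have h01 : crtCoeff p vH a 0 1 = crtCoeff p vH a 0 0 := by
      unfold crtCoeff
      rw [max_eq_left (Nat.one_le_iff_ne_zero.mpr ha1)]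
      simp only [Nat.max_zero]
    have h11 : crtCoeff p vH a 1 1 = crtCoeff p vH a 1 0 := by
      unfold crtCoeff
      rw [max_eq_left (Nat.one_le_iff_ne_zero.mpr ha1)]
      simp only [Nat.max_zero]
    rw [h01, h11]
    have hfac : ((crtCoeff p vH a 0 0 : ℝ) : ℂ) + ((crtCoeff p vH a 1 0 : ℝ) : ℂ) * (P₀ - 1) +
        ((crtCoeff p vH a 0 0 : ℝ) : ℂ) * (P₁ - 1) +
        ((crtCoeff p vH a 1 0 : ℝ) : ℂ) * ((P₀ - 1) * (P₁ - 1)) =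
        P₁ * (((crtCoeff p vH a 0 0 : ℝ) : ℂ) + ((crtCoeff p vH a 1 0 : ℝ) : ℂ) * (P₀ - 1)) := by
      ring
    rw [hfac]
    exact key P₁ (P₀ - 1) _ _ hP₁n hS₀n (crtCoeff_nonneg _ _ _ _ _)
      (crtCoeff_le_zero_zero hp 1 0)

/-- `c(0,0) ≤ p^{v_p H}/p^{a₀+a₁}` (if `min(a₀,a₁) ≤ v_pH` then `max(a₀,a₁) ≥ a₀ + a₁ - v_pH`); this is
the source's "`d ≍ d₁ ⋯ d_k`". [cite: TaoTeravainen2021, Lemma 3.3 (ii) ("`d ≍ d₁⋯d_{k'}`")] -/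
theorem crtCoeff_zero_zero_le (hp : 1 ≤ p) :
    crtCoeff p vH a 0 0 ≤ (p : ℝ) ^ vH / (p : ℝ) ^ (a 0 + a 1) := by
  have hp0 : (0 : ℝ) < p := by exact_mod_cast hp
  have hp1 : (1 : ℝ) ≤ p := by exact_mod_cast hp
  rw [crtCoeff_zero_zero]
  split_ifs with h
  · rw [inv_eq_one_div, div_le_div_iff₀ (by positivity) (by positivity), one_mul, ← pow_add]
    refine pow_le_pow_right₀ hp1 ?_
    have : min (a 0) (a 1) + max (a 0) (a 1) = a 0 + a 1 := min_add_max _ _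
    omega
  · positivity

end LocalBounds

/-! ### The slot powers at a prime `p < R` -/

/-- The size parameter `σ_τ = 1 + ∑_k |τ_k|` ("Changing variables using the substitution
`σ := 1 + ∑_j |t'_j| + |t''_j|`"). [cite: TaoTeravainen2021, §3.2 (proof of Lemma 3.4)] -/
def tauSize (τ : Fin 4 → ℝ) : ℝ :=
  1 + ∑ k, |τ k|

/-- `σ_τ ≥ 1`. [folklore] -/
theorem one_le_tauSize (τ : Fin 4 → ℝ) : 1 ≤ tauSize τ := by
  unfold tauSize
  have : 0 ≤ ∑ k, |τ k| := Finset.sum_nonneg fun k _ => abs_nonneg _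
  linarith

/-- `1 + |τ_k| ≤ σ_τ`. [folklore] -/
theorem abs_le_tauSize (τ : Fin 4 → ℝ) (k : Fin 4) : 1 + |τ k| ≤ tauSize τ := by
  unfold tauSize
  have : |τ k| ≤ ∑ j, |τ j| :=
    Finset.single_le_sum (f := fun j => |τ j|) (fun j _ => abs_nonneg _) (Finset.mem_univ k)
  linarith

/-- The gain parameter `μ_p(σ) = min(σ log_R p, 1)`. [cite: TaoTeravainen2021, Lemma 3.4 (the factors `min(σ log_R p, 1)`)] -/
def gainMin (R σ : ℝ) (p : ℕ) : ℝ :=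
  min (σ * Real.log p / Real.log R) 1

/-- `min(σ log_R p, 1) ≥ 0`. [folklore] -/
theorem gainMin_nonneg {R σ : ℝ} (hR : 1 < R) (hσ : 0 ≤ σ) {p : ℕ} (hp : 1 ≤ p) : 0 ≤ gainMin R σ p := by
  unfold gainMin
  refine le_min ?_ zero_le_one
  have : 0 ≤ Real.log p := Real.log_nonneg (by exact_mod_cast hp)
  have : 0 < Real.log R := Real.log_pos hR
  positivity

/-- `min(σ log_R p, 1) ≤ 1`. [folklore] -/
theorem gainMin_le_one (R σ : ℝ) (p : ℕ) : gainMin R σ p ≤ 1 := min_le_right _ _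

/-- **The slot powers at `p < R`**: `‖1 - p^{s_{τ_k}}‖ ≤ m_p := min(2πσ log_R p, 4)` for all four
slots (on `Y`, by `|p^s - 1| ≤ (2 Re s + |Im s|) log p` and `|p^s| ≤ e`; off `Y` the power is `1`),
and `m_p² ≤ 27 min(σ log_R p, 1)`. [cite: TaoTeravainen2021, §3.2 (proof of Lemma 3.4: "complex numbers of size `O(1/log p)`", "Cauchy integral formula")] -/
theorem norm_one_sub_cpow_slotExp_le {R : ℝ} (hR : Real.exp 1 ≤ R) {p : ℕ} (hp : p.Prime)
    (hpR : (p : ℝ) < R) (Y : Finset (Fin 4)) (τ : Fin 4 → ℝ) (k : Fin 4) :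
    ‖1 - (p : ℂ) ^ slotExp R Y τ k‖ ≤
      min (2 * Real.pi * tauSize τ * Real.log p / Real.log R) 4 := by
  have hR1 : 1 < R := lt_of_lt_of_le (by linarith [Real.add_one_le_exp 1]) hR
  have hlogR : 0 < Real.log R := Real.log_pos hR1
  have hlogR1 : 1 ≤ Real.log R := by
    rw [← Real.log_exp 1]
    exact Real.log_le_log (Real.exp_pos 1) hR
  have hp1 : (1 : ℝ) ≤ p := by exact_mod_cast hp.one_lt.le
  have hlogp : 0 ≤ Real.log p := Real.log_nonneg hp1
  have hlogpR : Real.log p ≤ Real.log R := Real.log_le_log (by linarith) hpR.le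
  have hσ := one_le_tauSize τ
  have hpi : (2 : ℝ) ≤ 2 * Real.pi := by linarith [Real.pi_gt_three]
  unfold slotExp
  by_cases hk : k ∈ Y
  · rw [if_pos hk]
    refine le_min ?_ ?_
    · -- `|p^s - 1| ≤ (2 Re s + |Im s|) log p ≤ 2π(1 + |τ_k|) log p / log R`
      have h := norm_cpow_sub_one_le hp1 (s := sParam R (τ k)) (by rw [sParam_re]; positivity)
        (by rw [sParam_re, one_div, inv_mul_le_iff₀ hlogR]; simpa using hlogpR)
      rw [norm_sub_rev] at h
      rw [sParam_re, sParam_im] at h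
      calc ‖1 - (p : ℂ) ^ sParam R (τ k)‖
          ≤ (2 * (1 / Real.log R) + |2 * Real.pi * τ k / Real.log R|) * Real.log p := h
        _ = (2 + 2 * Real.pi * |τ k|) * Real.log p / Real.log R := by
            rw [abs_div, abs_of_pos hlogR, abs_mul, abs_of_pos (by positivity : (0 : ℝ) < 2 * Real.pi)]
            field_simp
        _ ≤ (2 * Real.pi * (1 + |τ k|)) * Real.log p / Real.log R := by
            gcongr
            nlinarith [abs_nonneg (τ k)]
        _ ≤ 2 * Real.pi * tauSize τ * Real.log p / Real.log R := by
            have := abs_le_tauSize τ k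
            gcongr
    · -- `|1 - p^s| ≤ 1 + |p^s| = 1 + p^{1/log R} ≤ 1 + e ≤ 4`
      calc ‖1 - (p : ℂ) ^ sParam R (τ k)‖ ≤ ‖(1 : ℂ)‖ + ‖(p : ℂ) ^ sParam R (τ k)‖ := norm_sub_le _ _
        _ = 1 + (p : ℝ) ^ (1 / Real.log R) := by
            rw [norm_one, norm_natCast_cpow_of_ne_zero hp.ne_zero, sParam_re]
        _ ≤ 1 + Real.exp 1 := by
            gcongr
            rw [Real.rpow_def_of_pos (by linarith), Real.exp_le_exp, one_div, mul_inv_le_iff₀ hlogR,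
              one_mul]
            exact hlogpR
        _ ≤ 4 := by linarith [Real.exp_one_lt_d9]
  · rw [if_neg hk, Complex.cpow_zero, sub_self, norm_zero]
    refine le_min ?_ (by norm_num)
    positivity

/-- `m_p² ≤ 27 μ_p`: `min(2πσ log_R p, 4)² ≤ 27 min(σ log_R p, 1)`. [folklore] -/
theorem min_sq_le_gainMin {R : ℝ} (hR : 1 < R) (σ : ℝ) (hσ : 1 ≤ σ) {p : ℕ} (hp : 1 ≤ p) :
    (min (2 * Real.pi * σ * Real.log p / Real.log R) 4) ^ 2 ≤ 27 * gainMin R σ p := by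
  have hpi3 : (3 : ℝ) < Real.pi := Real.pi_gt_three
  have hpi4 : Real.pi < 3.15 := Real.pi_lt_d2
  have hlogR : 0 < Real.log R := Real.log_pos hR
  have hlogp : 0 ≤ Real.log p := Real.log_nonneg (by exact_mod_cast hp)
  set x : ℝ := σ * Real.log p / Real.log R with hx
  have hx0 : 0 ≤ x := by positivity
  have hrw : 2 * Real.pi * σ * Real.log p / Real.log R = 2 * Real.pi * x := by
    rw [hx]; ring
  rw [hrw]
  unfold gainMin
  rw [← hx]
  by_cases h1 : x ≤ 1
  · rw [min_eq_left h1]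
    by_cases h2 : 2 * Real.pi * x ≤ 4
    · rw [min_eq_left h2]
      have h3 : (2 * Real.pi * x) ^ 2 ≤ 4 * (2 * Real.pi * x) := by
        rw [sq]
        exact mul_le_mul_of_nonneg_right h2 (by positivity)
      nlinarith
    · push Not at h2
      rw [min_eq_right h2.le]
      nlinarith
  · push Not at h1
    rw [min_eq_right h1.le]
    have h2 : ¬ 2 * Real.pi * x ≤ 4 := by nlinarith
    rw [min_eq_right (le_of_lt (not_le.mp h2))]
    norm_num


/-! ### Arithmetic of the prime factorisations of `d₀ d₁` and `h₁ - h₂` -/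

/-- `∏_{p ∣ d₀ d₁} p^{v_p d₀ + v_p d₁} = d₀ d₁`. [folklore] -/
theorem prod_primeFactors_pow_add {d₀ d₁ : ℕ} (h0 : d₀ ≠ 0) (h1 : d₁ ≠ 0) :
    ∏ p ∈ (d₀ * d₁).primeFactors, p ^ (d₀.factorization p + d₁.factorization p) = d₀ * d₁ := by
  have hmul : d₀ * d₁ ≠ 0 := Nat.mul_ne_zero h0 h1
  conv_rhs => rw [← Nat.prod_factorization_pow_eq_self hmul]
  rw [Finsupp.prod, Nat.support_factorization]
  refine Finset.prod_congr rfl fun p _ => ?_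
  rw [Nat.factorization_mul h0 h1, Finsupp.add_apply]

/-- `∏_{p ∈ S} p^{v_p H} ≤ H` for a set of primes `S` (`H ≥ 1`). [folklore] -/
theorem prod_pow_factorization_le {H : ℕ} (hH : H ≠ 0) (S : Finset ℕ) :
    ∏ p ∈ S, p ^ H.factorization p ≤ H := by
  classical
  have h1 : ∏ p ∈ S, p ^ H.factorization p = ∏ p ∈ S ∩ H.primeFactors, p ^ H.factorization p := by
    rw [← Finset.prod_filter_mul_prod_filter_not S (fun p => p ∈ H.primeFactors)]
    have hone : ∏ p ∈ S.filter (fun p => p ∉ H.primeFactors), p ^ H.factorization p = 1 :=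
      Finset.prod_eq_one fun p hp => by
        rw [Finset.mem_filter] at hp
        have : H.factorization p = 0 := by
          apply Finsupp.notMem_support_iff.mp
          rw [Nat.support_factorization]
          exact hp.2
        rw [this, pow_zero]
    rw [hone, mul_one, Finset.filter_mem_eq_inter]
  rw [h1]
  calc ∏ p ∈ S ∩ H.primeFactors, p ^ H.factorization p
      ≤ ∏ p ∈ H.primeFactors, p ^ H.factorization p :=
        Finset.prod_le_prod_of_subset_of_one_le' Finset.inter_subset_right fun p hp _ =>
          Nat.one_le_pow _ _ (Nat.prime_of_mem_primeFactors hp).pos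
    _ = H := by
        conv_rhs => rw [← Nat.prod_factorization_pow_eq_self hH]
        rw [Finsupp.prod, Nat.support_factorization]

/-! ### The kernel bound -/

/-- The weight carrying the size `1/(d₀d₁)`, the divisor-type loss `1944^{ω(d₀d₁)}` and the gain
`∏_{p ∣ d₀d₁, p < R} min(σ log_R p, 1)` of Lemma 3.4 (`k = 2`). [cite: TaoTeravainen2021, Lemma 3.4] -/
def gainWeight (R : ℝ) (d : Fin 2 → ℕ) (σ : ℝ) : ℝ :=
  (1944 : ℝ) ^ (d 0 * d 1).primeFactors.card / ((d 0 : ℝ) * d 1) *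
    ∏ p ∈ (sievePrimes R).filter (fun p => p ∣ d 0 * d 1), gainMin R σ p

/-- `gainWeight ≥ 0`. [folklore] -/
theorem gainWeight_nonneg {R : ℝ} (hR : 1 < R) (d : Fin 2 → ℕ) {σ : ℝ} (hσ : 0 ≤ σ) :
    0 ≤ gainWeight R d σ := by
  unfold gainWeight
  refine mul_nonneg (by positivity) (Finset.prod_nonneg fun p hp => ?_)
  exact gainMin_nonneg hR hσ (prime_of_mem_sievePrimes (Finset.mem_filter.mp hp).1).one_lt.le

/-- The constant of the kernel bound (depends on the shifts only):
`C_K = C₀² · 652^{ω(h₁-h₂)} · e^{6480} · |h₁-h₂|`, `C₀ = 4e^{6/log 2} log 2` (Mertens).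
[cite: TaoTeravainen2021, Lemma 3.4] -/
def kernelConst (h₁ h₂ : ℕ) : ℝ :=
  (4 * Real.exp (6 / Real.log 2) * Real.log 2) ^ 2 * (652 : ℝ) ^ (shiftDiff h₁ h₂).primeFactors.card *
    Real.exp 6480 * shiftDiff h₁ h₂

/-- `C_K > 0`. [folklore] -/
theorem kernelConst_pos {h₁ h₂ : ℕ} (hne : h₁ ≠ h₂) : 0 < kernelConst h₁ h₂ := by
  unfold kernelConst
  have hH : (0 : ℝ) < shiftDiff h₁ h₂ := by exact_mod_cast Nat.pos_of_ne_zero (shiftDiff_ne_zero hne)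
  have : 0 < Real.log 2 := Real.log_pos (by norm_num)
  positivity


/-- (3.3) on the primes `< R`: `∑_{p < R} min(σ log_R p, 1)/p ≤ log σ + 30` (`R ≥ 3`, `σ ≥ 1`; the
tree's `sum_min_div_prime_le`). [cite: TaoTeravainen2021, §3.1 (3.3)] -/
theorem sum_gainMin_div_le {R : ℝ} (hR : 3 ≤ R) {σ : ℝ} (hσ : 1 ≤ σ) :
    ∑ p ∈ sievePrimes R, gainMin R σ p / p ≤ Real.log σ + 30 := by
  have hR0 : 0 ≤ R := by linarith
  have hceil : 3 ≤ ⌈R⌉₊ := by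
    have : (3 : ℝ) ≤ ⌈R⌉₊ := hR.trans (Nat.le_ceil R)
    exact_mod_cast this
  set M := ⌈R⌉₊ - 1 with hM
  have hM2 : 2 ≤ M := by omega
  have hM1 : M + 1 = ⌈R⌉₊ := by omega
  have hMR : (M : ℝ) ≤ R := by
    have h1 : (⌈R⌉₊ : ℝ) < R + 1 := Nat.ceil_lt_add_one hR0
    have h2 : ((M + 1 : ℕ) : ℝ) = ⌈R⌉₊ := by rw [hM1]
    push_cast at h2
    linarith
  have hL : Real.log M ≤ Real.log R :=
    Real.log_le_log (by exact_mod_cast (show 0 < M by omega)) hMR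
  have h := sum_min_div_prime_le hM2 hσ hL
  have hPM : sievePrimes R = Nat.primesBelow (M + 1) := by
    rw [sievePrimes, hM1]
  rw [hPM]
  simpa [gainMin] using h

set_option maxHeartbeats 1600000 in
/-- **The pointwise bound for the kernel** ("it will suffice to establish the pointwise bound
`∑ … ≪ σ^{O(1)} τ(d')^{O(1)}/(d' log^k R) ∏_{p∣d} min(σ log_R p, 1)` for all `t'₁,…,t''_k ∈ ℝ`"),
here for `k = 2` with explicit constants: for `h₁ ≠ h₂`, `R ≥ 3`, `d₀, d₁ ≥ 1` and every `Y`, `τ`,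
`‖K_Y(τ)‖ ≤ C_K σ_τ^{216}/log² R · (1944^{ω(d₀d₁)}/(d₀d₁)) ∏_{p∣d₀d₁, p<R} min(σ_τ log_R p, 1)`.
[cite: TaoTeravainen2021, §3.2 (proof of Lemma 3.4, the pointwise bound and the estimates for `E_p`)] -/
theorem norm_sieveKernel_le {h₁ h₂ : ℕ} (hne : h₁ ≠ h₂) {R : ℝ} (hR : 3 ≤ R) {d : Fin 2 → ℕ}
    (hd : ∀ j, d j ≠ 0) (Y : Finset (Fin 4)) (τ : Fin 4 → ℝ) :
    ‖sieveKernel R h₁ h₂ d Y τ‖ ≤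
      kernelConst h₁ h₂ * tauSize τ ^ 216 / Real.log R ^ 2 * gainWeight R d (tauSize τ) := by
  classical
  -- notation
  set H := shiftDiff h₁ h₂ with hHdef
  have hH0 : H ≠ 0 := shiftDiff_ne_zero hne
  set P := sievePrimes R with hPdef
  have hP : ∀ p ∈ P, p.Prime := fun p hp => prime_of_mem_sievePrimes hp
  have hPR : ∀ p ∈ P, (p : ℝ) < R := fun p hp => (mem_sievePrimes.mp hp).1
  set σ := tauSize τ with hσdef
  have hσ1 : 1 ≤ σ := one_le_tauSize τ
  have hσ0 : 0 < σ := by linarith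
  have hRe : Real.exp 1 ≤ R := le_trans (le_of_lt (lt_trans Real.exp_one_lt_d9 (by norm_num))) hR
  have hR1 : 1 < R := by linarith
  have hlogR : 0 < Real.log R := Real.log_pos hR1
  set w := slotExp R Y τ with hwdef
  set vH : ℕ → ℕ := fun p => H.factorization p with hvHdef
  set a : ℕ → Fin 2 → ℕ := fun p j => (d j).factorization p with hadef
  set μg : ℕ → ℝ := fun p => gainMin R σ p with hμdef
  set g : ℕ → ℝ := fun p => (p : ℝ) ^ vH p / (p : ℝ) ^ (a p 0 + a p 1) with hgdef
  set f : ℕ → ℝ := fun p => (1 - (p : ℝ)⁻¹) ^ 2 with hfdef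
  have hg0 : ∀ p, 0 ≤ g p := fun p => by simp only [hgdef]; positivity
  have hμ0 : ∀ p ∈ P, 0 ≤ μg p := fun p hp => gainMin_nonneg hR1 hσ0.le (hP p hp).one_lt.le
  -- the Euler product
  rw [sieveKernel_eq_prod hne hd Y τ, norm_mul, Complex.norm_real, Real.norm_eq_abs,
    abs_of_nonneg (outsideFactor_nonneg R h₁ h₂ d), norm_prod]
  -- the termwise bound `‖E_p‖ ≤ B_p`
  set B : ℕ → ℝ := fun p =>
    if p ∣ d 0 * d 1 then 486 * μg p * g p
    else if p ∣ H then 163 else f p * (1 + 216 * μg p / p) with hBdef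
  have hEB : ∀ p ∈ P, ‖localFactor p (vH p) (a p) w‖ ≤ B p := by
    intro p hp
    have hpp := hP p hp
    have hp2 : 2 ≤ p := hpp.two_le
    have hp1 : 1 ≤ p := hpp.one_lt.le
    have hp0 : (0 : ℝ) < p := by exact_mod_cast hpp.pos
    set m : ℝ := min (2 * Real.pi * σ * Real.log p / Real.log R) 4 with hmdef
    have hu : ∀ k, ‖1 - (p : ℂ) ^ w k‖ ≤ m := fun k =>
      norm_one_sub_cpow_slotExp_le hRe hpp (hPR p hp) Y τ k
    have hm0 : 0 ≤ m := (norm_nonneg _).trans (hu 0)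
    have hm4 : m ≤ 4 := min_le_right _ _
    have hm2 : m ^ 2 ≤ 27 * μg p := min_sq_le_gainMin hR1 σ hσ1 hp1
    by_cases hpd : p ∣ d 0 * d 1
    · simp only [hBdef, if_pos hpd]
      have ha : a p 0 ≠ 0 ∨ a p 1 ≠ 0 := by
        rcases (Nat.Prime.dvd_mul hpp).mp hpd with h | h
        · exact Or.inl (Nat.pos_iff_ne_zero.mp (hpp.factorization_pos_of_dvd (hd 0) h))
        · exact Or.inr (Nat.pos_iff_ne_zero.mp (hpp.factorization_pos_of_dvd (hd 1) h))
      have h1 := norm_localFactor_dvd_le (vH := vH p) hp1 ha hm0 hm4 hu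
      have h2 : crtCoeff p (vH p) (a p) 0 0 ≤ g p := crtCoeff_zero_zero_le (vH := vH p) (a := a p) hp1
      have hc0 : 0 ≤ crtCoeff p (vH p) (a p) 0 0 := crtCoeff_nonneg _ _ _ _ _
      have hμp : 0 ≤ μg p := hμ0 p hp
      calc ‖localFactor p (vH p) (a p) w‖ ≤ 18 * m ^ 2 * crtCoeff p (vH p) (a p) 0 0 := h1
        _ ≤ 18 * (27 * μg p) * g p :=
            mul_le_mul (mul_le_mul_of_nonneg_left hm2 (by norm_num)) h2 hc0 (by positivity)
        _ = 486 * μg p * g p := by ring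
    · simp only [hBdef, if_neg hpd]
      have ha0 : a p 0 = 0 :=
        Nat.factorization_eq_zero_of_not_dvd fun h => hpd (Dvd.dvd.mul_right h (d 1))
      have ha1 : a p 1 = 0 :=
        Nat.factorization_eq_zero_of_not_dvd fun h => hpd (Dvd.dvd.mul_left h (d 0))
      by_cases hpH : p ∣ H
      · simp only [if_pos hpH]
        have hvH1 : 1 ≤ vH p := hpp.factorization_pos_of_dvd hH0 hpH
        exact norm_localFactor_dvd_shift_le hp2 hvH1 ha0 ha1 hm0 hm4 hu
      · simp only [if_neg hpH]
        have hvH0 : vH p = 0 := Nat.factorization_eq_zero_of_not_dvd hpH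
        rw [hvH0]
        calc ‖localFactor p 0 (a p) w‖ ≤ (1 - (p : ℝ)⁻¹) ^ 2 * (1 + 8 * m ^ 2 / p) :=
              norm_localFactor_generic_le hp2 ha0 ha1 hm0 hu
          _ ≤ f p * (1 + 216 * μg p / p) := by
              simp only [hfdef]
              gcongr (1 - (p : ℝ)⁻¹) ^ 2 * (1 + ?_)
              rw [div_le_div_iff_of_pos_right hp0]
              linarith
  have hB0 : ∀ p ∈ P, 0 ≤ B p := fun p hp => (norm_nonneg _).trans (hEB p hp)
  have hprod : ∏ p ∈ P, ‖localFactor p (vH p) (a p) w‖ ≤ ∏ p ∈ P, B p :=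
    Finset.prod_le_prod (fun p _ => norm_nonneg _) hEB
  -- the three classes of primes
  set Pd := P.filter (fun p => p ∣ d 0 * d 1) with hPddef
  set Pr := P.filter (fun p => ¬ p ∣ d 0 * d 1) with hPrdef
  set PH := Pr.filter (fun p => p ∣ H) with hPHdef
  set Pg := Pr.filter (fun p => ¬ p ∣ H) with hPgdef
  have hsplitB : ∏ p ∈ P, B p = (∏ p ∈ Pd, B p) * ((∏ p ∈ PH, B p) * ∏ p ∈ Pg, B p) := by
    rw [← Finset.prod_filter_mul_prod_filter_not P (fun p => p ∣ d 0 * d 1),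
      ← Finset.prod_filter_mul_prod_filter_not Pr (fun p => p ∣ H)]
  have hPdB : ∏ p ∈ Pd, B p = 486 ^ #Pd * (∏ p ∈ Pd, μg p) * ∏ p ∈ Pd, g p := by
    have : ∀ p ∈ Pd, B p = 486 * μg p * g p := fun p hp => by
      simp only [hBdef, if_pos (Finset.mem_filter.mp hp).2]
    rw [Finset.prod_congr rfl this, Finset.prod_mul_distrib, Finset.prod_mul_distrib,
      Finset.prod_const]
  have hPHB : ∏ p ∈ PH, B p = 163 ^ #PH := by
    have : ∀ p ∈ PH, B p = 163 := fun p hp => by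
      have h1 := Finset.mem_filter.mp hp
      have h2 := Finset.mem_filter.mp h1.1
      simp only [hBdef, if_neg h2.2, if_pos h1.2]
    rw [Finset.prod_congr rfl this, Finset.prod_const]
  have hPgB : ∏ p ∈ Pg, B p = (∏ p ∈ Pg, f p) * ∏ p ∈ Pg, (1 + 216 * μg p / p) := by
    have : ∀ p ∈ Pg, B p = f p * (1 + 216 * μg p / p) := fun p hp => by
      have h1 := Finset.mem_filter.mp hp
      have h2 := Finset.mem_filter.mp h1.1
      simp only [hBdef, if_neg h2.2, if_neg h1.2]
    rw [Finset.prod_congr rfl this, Finset.prod_mul_distrib]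
  have hPdP : Pd ⊆ P := Finset.filter_subset _ _
  have hPHP : PH ⊆ P := (Finset.filter_subset _ _).trans (Finset.filter_subset _ _)
  have hPgP : Pg ⊆ P := (Finset.filter_subset _ _).trans (Finset.filter_subset _ _)
  -- (i) the exponential bound on the generic primes
  have h33 : ∑ p ∈ P, μg p / p ≤ Real.log σ + 30 := sum_gainMin_div_le hR hσ1
  have hexp : ∏ p ∈ Pg, (1 + 216 * μg p / p) ≤ σ ^ 216 * Real.exp 6480 := by
    have hsum : ∑ p ∈ Pg, 216 * μg p / p ≤ 216 * (Real.log σ + 30) := by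
      calc ∑ p ∈ Pg, 216 * μg p / p = 216 * ∑ p ∈ Pg, μg p / p := by
            rw [Finset.mul_sum]
            exact Finset.sum_congr rfl fun p _ => by ring
        _ ≤ 216 * ∑ p ∈ P, μg p / p :=
            mul_le_mul_of_nonneg_left (Finset.sum_le_sum_of_subset_of_nonneg hPgP fun p hp _ =>
              div_nonneg (hμ0 p hp) (Nat.cast_nonneg p)) (by norm_num)
        _ ≤ 216 * (Real.log σ + 30) := mul_le_mul_of_nonneg_left h33 (by norm_num)
    calc ∏ p ∈ Pg, (1 + 216 * μg p / p) ≤ ∏ p ∈ Pg, Real.exp (216 * μg p / p) :=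
          Finset.prod_le_prod (fun p hp => by
              have := hμ0 p (hPgP hp)
              positivity)
            fun p _ => by linarith [Real.add_one_le_exp (216 * μg p / p)]
      _ = Real.exp (∑ p ∈ Pg, 216 * μg p / p) := (Real.exp_sum _ _).symm
      _ ≤ Real.exp (216 * (Real.log σ + 30)) := Real.exp_le_exp.mpr hsum
      _ = σ ^ 216 * Real.exp 6480 := by
          rw [mul_add, Real.exp_add, show (216 : ℝ) * Real.log σ = ((216 : ℕ) : ℝ) * Real.log σ by
            norm_num, Real.exp_nat_mul, Real.exp_log hσ0]
          norm_num
  -- (ii) Mertens with compensation on the non-generic primes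
  have hf_bounds : ∀ p ∈ P, 1 / 4 ≤ f p ∧ f p ≤ 1 := by
    intro p hp
    have hp2 : (2 : ℝ) ≤ p := by exact_mod_cast (hP p hp).two_le
    have hinv : (p : ℝ)⁻¹ ≤ 1 / 2 := by
      rw [inv_eq_one_div]; exact one_div_le_one_div_of_le two_pos hp2
    have hinv0 : 0 ≤ (p : ℝ)⁻¹ := by positivity
    simp only [hfdef]
    constructor <;> nlinarith
  have hfsplit : ∏ p ∈ P, f p = (∏ p ∈ Pd, f p) * ((∏ p ∈ PH, f p) * ∏ p ∈ Pg, f p) := by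
    rw [← Finset.prod_filter_mul_prod_filter_not P (fun p => p ∣ d 0 * d 1),
      ← Finset.prod_filter_mul_prod_filter_not Pr (fun p => p ∣ H)]
  have hlow : ∀ S ⊆ P, (1 / 4 : ℝ) ^ #S ≤ ∏ p ∈ S, f p := by
    intro S hS
    rw [← Finset.prod_const]
    exact Finset.prod_le_prod (fun _ _ => by norm_num) fun p hp => (hf_bounds p (hS hp)).1
  have hMert : ∏ p ∈ P, f p ≤ (4 * Real.exp (6 / Real.log 2) * Real.log 2) ^ 2 / Real.log R ^ 2 := by
    have h1 : ∏ p ∈ P, f p = (∏ p ∈ P, (1 - (p : ℝ)⁻¹)) ^ 2 := by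
      simp only [hfdef]
      rw [Finset.prod_pow]
    have h2 := Literature.NumberTheory.Sieve.prod_primesBelow_one_sub_inv_le hR
    have h3 : 0 ≤ ∏ p ∈ P, (1 - (p : ℝ)⁻¹) := Finset.prod_nonneg fun p hp => by
      have hp2 : (2 : ℝ) ≤ p := by exact_mod_cast (hP p hp).two_le
      have : (p : ℝ)⁻¹ ≤ 1 / 2 := by
        rw [inv_eq_one_div]; exact one_div_le_one_div_of_le two_pos hp2
      linarith
    rw [h1, ← div_pow]
    exact pow_le_pow_left₀ h3 h2 2
  have hPgf : ∏ p ∈ Pg, f p ≤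
      (4 * Real.exp (6 / Real.log 2) * Real.log 2) ^ 2 / Real.log R ^ 2 * 4 ^ #Pd * 4 ^ #PH := by
    have h1 : (∏ p ∈ Pg, f p) * ((1 / 4 : ℝ) ^ #Pd * (1 / 4 : ℝ) ^ #PH) ≤ ∏ p ∈ P, f p := by
      rw [hfsplit]
      have hPg0 : 0 ≤ ∏ p ∈ Pg, f p := Finset.prod_nonneg fun p hp => by
        linarith [(hf_bounds p (hPgP hp)).1]
      calc (∏ p ∈ Pg, f p) * ((1 / 4 : ℝ) ^ #Pd * (1 / 4 : ℝ) ^ #PH)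
          ≤ (∏ p ∈ Pg, f p) * ((∏ p ∈ Pd, f p) * ∏ p ∈ PH, f p) :=
            mul_le_mul_of_nonneg_left (mul_le_mul (hlow Pd hPdP) (hlow PH hPHP) (by positivity)
              (Finset.prod_nonneg fun p hp => by linarith [(hf_bounds p (hPdP hp)).1])) hPg0
        _ = _ := by ring
    have h4 : (0 : ℝ) < (1 / 4 : ℝ) ^ #Pd * (1 / 4 : ℝ) ^ #PH := by positivity
    rw [← le_div_iff₀ h4] at h1
    refine h1.trans ?_
    rw [div_le_iff₀ h4]
    calc ∏ p ∈ P, f p ≤ (4 * Real.exp (6 / Real.log 2) * Real.log 2) ^ 2 / Real.log R ^ 2 := hMert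
      _ = (4 * Real.exp (6 / Real.log 2) * Real.log 2) ^ 2 / Real.log R ^ 2 * 4 ^ #Pd * 4 ^ #PH *
            ((1 / 4 : ℝ) ^ #Pd * (1 / 4 : ℝ) ^ #PH) := by
          rw [one_div, inv_pow, inv_pow]
          field_simp
  -- (iii) the primes dividing `d₀ d₁`
  set pf := (d 0 * d 1).primeFactors with hpfdef
  have hPdpf : Pd ⊆ pf := by
    intro p hp
    rw [Finset.mem_filter] at hp
    exact Nat.mem_primeFactors.mpr ⟨hP p hp.1, hp.2, Nat.mul_ne_zero (hd 0) (hd 1)⟩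
  have hA : outsideFactor R h₁ h₂ d ≤ ∏ p ∈ pf \ P, g p := by
    unfold outsideFactor
    refine Finset.prod_le_prod (fun p _ => localCrt_nonneg _ _ _ _) fun p hp => ?_
    have hpp : p.Prime := Nat.prime_of_mem_primeFactors (Finset.mem_sdiff.mp hp).1
    rw [localCrt_eq_crtCoeff, sideHit_empty, sideHit_empty]
    exact crtCoeff_zero_zero_le (vH := vH p) (a := a p) hpp.one_lt.le
  have hsd : pf \ P = pf \ Pd := by
    ext p
    simp only [Finset.mem_sdiff, hPddef, Finset.mem_filter, not_and]
    constructor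
    · rintro ⟨h1, h2⟩
      exact ⟨h1, fun h3 _ => h2 h3⟩
    · rintro ⟨h1, h2⟩
      exact ⟨h1, fun h3 => h2 h3 (Nat.dvd_of_mem_primeFactors h1)⟩
  have hcomb : (∏ p ∈ pf \ P, g p) * ∏ p ∈ Pd, g p = ∏ p ∈ pf, g p := by
    rw [hsd]
    exact Finset.prod_sdiff hPdpf
  have hpf : ∏ p ∈ pf, g p ≤ (H : ℝ) / ((d 0 : ℝ) * d 1) := by
    simp only [hgdef]
    rw [Finset.prod_div_distrib]
    have hden : ∏ p ∈ pf, (p : ℝ) ^ (a p 0 + a p 1) = (d 0 : ℝ) * d 1 := by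
      have := prod_primeFactors_pow_add (hd 0) (hd 1)
      rw [hpfdef]
      exact_mod_cast this
    have hnum : ∏ p ∈ pf, (p : ℝ) ^ vH p ≤ (H : ℝ) := by
      have := prod_pow_factorization_le hH0 pf
      exact_mod_cast this
    rw [hden]
    exact div_le_div_of_nonneg_right hnum (by positivity)
  -- cardinalities
  have hcardPd : #Pd ≤ #pf := Finset.card_le_card hPdpf
  have hcardPH : #PH ≤ #H.primeFactors := by
    refine Finset.card_le_card fun p hp => ?_
    have h1 := Finset.mem_filter.mp hp
    exact Nat.mem_primeFactors.mpr ⟨hP p (hPHP hp), h1.2, hH0⟩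
  -- assembly
  have hμprod0 : 0 ≤ ∏ p ∈ Pd, μg p := Finset.prod_nonneg fun p hp => hμ0 p (hPdP hp)
  have hC₀ : 0 < (4 * Real.exp (6 / Real.log 2) * Real.log 2) ^ 2 / Real.log R ^ 2 := by
    have : 0 < Real.log 2 := Real.log_pos (by norm_num)
    positivity
  calc outsideFactor R h₁ h₂ d * ∏ p ∈ P, ‖localFactor p (vH p) (a p) w‖
      ≤ outsideFactor R h₁ h₂ d * ∏ p ∈ P, B p :=
        mul_le_mul_of_nonneg_left hprod (outsideFactor_nonneg R h₁ h₂ d)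
    _ = (outsideFactor R h₁ h₂ d * ∏ p ∈ Pd, g p) * (486 ^ #Pd * ∏ p ∈ Pd, μg p) * 163 ^ #PH *
          (∏ p ∈ Pg, f p) * ∏ p ∈ Pg, (1 + 216 * μg p / p) := by
        rw [hsplitB, hPdB, hPHB, hPgB]
        ring
    _ ≤ ((H : ℝ) / ((d 0 : ℝ) * d 1)) * (486 ^ #Pd * ∏ p ∈ Pd, μg p) * 163 ^ #PH *
          ((4 * Real.exp (6 / Real.log 2) * Real.log 2) ^ 2 / Real.log R ^ 2 * 4 ^ #Pd * 4 ^ #PH) *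
          (σ ^ 216 * Real.exp 6480) := by
        have hAg : outsideFactor R h₁ h₂ d * ∏ p ∈ Pd, g p ≤ (H : ℝ) / ((d 0 : ℝ) * d 1) := by
          calc outsideFactor R h₁ h₂ d * ∏ p ∈ Pd, g p ≤ (∏ p ∈ pf \ P, g p) * ∏ p ∈ Pd, g p :=
                mul_le_mul_of_nonneg_right hA (Finset.prod_nonneg fun p _ => hg0 p)
            _ = ∏ p ∈ pf, g p := hcomb
            _ ≤ _ := hpf
        have hPgf0 : 0 ≤ ∏ p ∈ Pg, f p := Finset.prod_nonneg fun p hp => by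
          linarith [(hf_bounds p (hPgP hp)).1]
        have hPge0 : 0 ≤ ∏ p ∈ Pg, (1 + 216 * μg p / p) := Finset.prod_nonneg fun p hp => by
          have := hμ0 p (hPgP hp)
          positivity
        have hAg0 : 0 ≤ outsideFactor R h₁ h₂ d * ∏ p ∈ Pd, g p :=
          mul_nonneg (outsideFactor_nonneg R h₁ h₂ d) (Finset.prod_nonneg fun p _ => hg0 p)
        gcongr
    _ = ((4 * Real.exp (6 / Real.log 2) * Real.log 2) ^ 2 * (652 : ℝ) ^ #PH * Real.exp 6480 * H) *
          σ ^ 216 / Real.log R ^ 2 * ((1944 : ℝ) ^ #Pd / ((d 0 : ℝ) * d 1) * ∏ p ∈ Pd, μg p) := by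
        have e652 : (652 : ℝ) ^ #PH = 163 ^ #PH * 4 ^ #PH := by rw [← mul_pow]; norm_num
        have e1944 : (1944 : ℝ) ^ #Pd = 486 ^ #Pd * 4 ^ #Pd := by rw [← mul_pow]; norm_num
        rw [e652, e1944]
        field_simp
    _ ≤ kernelConst h₁ h₂ * σ ^ 216 / Real.log R ^ 2 * gainWeight R d σ := by
        unfold kernelConst gainWeight
        have hd0 : (0 : ℝ) < (d 0 : ℝ) * d 1 := by
          have := Nat.pos_of_ne_zero (hd 0)
          have := Nat.pos_of_ne_zero (hd 1)
          positivity
        have hH' : (0 : ℝ) ≤ (H : ℝ) := Nat.cast_nonneg _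
        have h652 : (652 : ℝ) ^ #PH ≤ (652 : ℝ) ^ #(shiftDiff h₁ h₂).primeFactors :=
          pow_le_pow_right₀ (by norm_num) hcardPH
        have h1944 : (1944 : ℝ) ^ #Pd ≤ (1944 : ℝ) ^ #(d 0 * d 1).primeFactors :=
          pow_le_pow_right₀ (by norm_num) hcardPd
        have hlog2 : 0 < Real.log 2 := Real.log_pos (by norm_num)
        gcongr

end TaoTeravainen

end Literature.Barriers.Parity
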